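import Mathlib
import HarnessLib
import Summits.NavierStokesRegularity.NavierStokesRegularity.Theorems.CompletionRelayChainRelayFrontStepIgnitionWindowE
import Summits.NavierStokesRegularity.NavierStokesRegularity.Theorems.CompletionRelayChainRelayFrontStepIgnitionFloorsU2

/-!
# `CompletionRelayChain` — crux `RelayFrontStep` (24850), LINE `window_v2` (skeleton v7): the registered stub
  `stub_ignition` — PHASE II, THE IGNITION LEMMA (assembly)

From the END-BOX at `T* = 147/64` (`PhaseIEndBox`), the Phase-I envelope (`PhaseIEnvelope`) and the Phase-I facts on
`[0, T*]`, the pseudo-flow reaches a positive level-1 fire `u₁(τ₁) = ρ·x₁(τ₁)` at the first crossing time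
`τ₁ ∈ (T*, T* + 0.7)` (infimum of a closed nonempty set; nonempty because the Phase-II window lemma bounds every
pre-crossing window by `0.6813`), and at `τ₁` every landing / near-wake / envelope / integral clause holds: the
amplitude ratios and floors from the crossing band of the clock table (`landCheck`), the wake shells from
`near_wake_phaseII`, the floors from `…IgnitionFloors(U2)` and the chain, the envelope from the crude caps.
Ingredients: `phaseII_window` (tree `…IgnitionWindowE`), `near_wake_phaseI`, `x2_floor_phaseI`, `r1_floor_phaseI`,
`u2_floor_phaseI`, `runCheck_cover`, `ignitionTable_ok`.

HONEST FRAMING: a statement about pseudo-flows of the MODEL lattice TL-M3-R64 (Tao 2016 §4/§6 vocabulary), proving the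
registered stub of LINE `window_v2` of the OPEN crux `RelayFrontStep`; nothing here is a statement about the
Navier–Stokes equations, and the crux itself stays open until `stub_phaseI` (the kernel replay of the Phase-I tables) lands.
-/

noncomputable section

-- the summit-side namespace repeats a component by design (D-0017)
set_option linter.dupNamespace false

open Set MeasureTheory intervalIntegral Literature.Analysis.FluidPDE Literature.Analysis.FluidPDE.TaoCascade
open Summit.NavierStokesRegularity.NavierStokesRegularity.Theorems
open Summit.NavierStokesRegularity.NavierStokesRegularity.Theorems.RelayFrontStep

namespace Summit.NavierStokesRegularity.NavierStokesRegularity.Cruxes.RelayFrontStep.Window2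

/-- `relayEnv₂ 0 = 2`. [this file] -/
theorem relayEnv₂_zero : relayEnv₂ 0 = 2 := by
  unfold relayEnv₂; rw [if_pos (by norm_num)]; norm_num

set_option maxHeartbeats 20000000 in
/-- **THE IGNITION LEMMA** (registered stub `stub_ignition` of LINE `window_v2`, skeleton v7): see the module docstring.
MODEL lattice only; nothing about the Navier–Stokes equations. -/
theorem stub_ignition :
  ∀ α : Fin 4 → Fin 4 → Fin 4 → ℤ × ℤ × ℤ → ℝ, InTableClass 64 α → RelayRows α →
    ∀ (τ : ℝ) (S₀ F₀ B₀ : Fin 4 → ℤ → ℝ) (S F : Fin 4 → ℤ → ℝ → ℝ), RelayWindow₃ S₀ F₀ →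
      (∀ i k, 0 ≤ B₀ i k) →
      (∀ i, B₀ i (-3) ≤ 28 / 10 ^ 6) → (∀ i, B₀ i (-2) ≤ 14 / 10 ^ 6) → (∀ i, B₀ i (-1) ≤ 7 / 10 ^ 6) →
      (∀ i, B₀ i 0 ≤ 35 / 10 ^ 7) → (∀ i, B₀ i 1 ≤ 18 / 10 ^ 7) → (∀ i, B₀ i 2 ≤ 9 / 10 ^ 7) →
      8 ≤ τ → PseudoFlowOn τ 1 α (1 / 10 ^ 8) (1 / 10 ^ 8) S₀ F₀ B₀ S F →
      -- (T) tail forcing, for every initial window [0, t]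
      (∀ t ∈ Icc (0 : ℝ) τ, t ≤ 8 → (∫ s in (0 : ℝ)..t, S 1 2 s ^ 2) ≤ 1 / 10 ^ 11 →
        (∫ s in (0 : ℝ)..t, |S 2 2 s * S 1 2 s|) ≤ 1 / 10 ^ 13 →
          ∀ s ∈ Icc (0 : ℝ) t, ∑ i, F i 3 s ≤ 6 / 10 ^ 20) →
      -- (W) wake forcing on [0, 8] (unconditional: `block_apriori`)
      (∀ s ∈ Icc (0 : ℝ) τ, s ≤ 8 → ∑ i, F i (-4) s ≤ (1 + s / 20) * wakeS (-4)) →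
      -- (A) a priori bound on [0, 8]: every shell ≥ −3 carries at most 5/2 (unconditional: `block_apriori`)
      (∀ s ∈ Icc (0 : ℝ) τ, s ≤ 8 → ∀ k : ℤ, -3 ≤ k → ∑ i, F i k s ≤ 5 / 2) →
      PhaseIEndBox S F → PhaseIEnvelope S →
      (∀ s ∈ Icc (0 : ℝ) Tstar, ∀ (i : Fin 4) (k : ℤ), 0 ≤ k → k ≤ 2 → i ≠ 3 → F i k s ≤ relayEnv₂ k) →
      (∫ s in (0 : ℝ)..Tstar, S 1 2 s ^ 2) ≤ iota₁ →
      (∫ s in (0 : ℝ)..Tstar, |S 2 2 s * S 1 2 s|) ≤ iota₂ →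
      ∃ τ₁ : ℝ, 0 < τ₁ ∧ τ₁ ≤ 8 ∧ 17 / 20 ≤ S 0 1 τ₁ ∧
        S 1 1 τ₁ = 4175 / 10000 * S 0 1 τ₁ ∧
        -- front and next shell after rescaling (amplitudes, with floors)
        (-(1 / 10 ^ 6) ≤ S 2 1 τ₁ / S 0 1 τ₁ ∧ S 2 1 τ₁ / S 0 1 τ₁ ≤ 12 / 10000 ∧
          -(1 / 10 ^ 8) ≤ S 0 2 τ₁ / S 0 1 τ₁ ∧ S 0 2 τ₁ / S 0 1 τ₁ ≤ 15 / 100 ∧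
          -(1 / 10 ^ 8) ≤ S 1 2 τ₁ / S 0 1 τ₁ ∧ S 1 2 τ₁ / S 0 1 τ₁ ≤ 1 / 100000 ∧
          -(1 / 10 ^ 8) ≤ S 2 2 τ₁ / S 0 1 τ₁ ∧ S 2 2 τ₁ / S 0 1 τ₁ ≤ 1 / 100000) ∧
        -- near wake (new offsets −4 … −1 = old shells −3 … 0), SHELL energies
        (∀ k : ℤ, -4 ≤ k → k ≤ -1 → (∑ i, F i (1 + k) τ₁) / S 0 1 τ₁ ^ 2 ≤ wakeS k) ∧
        -- epoch envelope of old shells 0, 1, 2 on the hop (per mode; shells −3 … −1 are covered by (A))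
        (∀ s ∈ Icc (0 : ℝ) τ₁, ∀ (i : Fin 4) (k : ℤ), 0 ≤ k → k ≤ 2 → i ≠ 3 → F i k s ≤ relayEnv₂ k) ∧
        -- old shell 2's trigger / relay, time-integrated (the tail's input)
        (∫ s in (0 : ℝ)..τ₁, S 1 2 s ^ 2) ≤ 1 / 10 ^ 11 ∧
        (∫ s in (0 : ℝ)..τ₁, |S 2 2 s * S 1 2 s|) ≤ 1 / 10 ^ 13 := by
  intro α hE hrows τ S₀ F₀ B₀ S F hW hB0 hBm3 hBm2 hBm1 hB00 hB1 hB2 hτ8 hflow hT hW4 hA hbox henv hEnv hI1 hI2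
  have hτ : 0 < τ := by linarith
  have hT0 : (0 : ℝ) ≤ Tstar := by unfold Tstar; norm_num
  have hTpos : (0 : ℝ) < Tstar := by unfold Tstar; norm_num
  have hTτ : Tstar ≤ τ := by unfold Tstar; linarith
  have hκ0 : (0 : ℝ) ≤ 1 / 10 ^ 8 := by norm_num
  -- the window clauses, the END-BOX, the envelope
  obtain ⟨_, _, _, _, _, _, _, _, hw9, _, hahead, hwake, _⟩ := hW
  obtain ⟨_, _, _, _, _, _, _, _, _, bx0, bu0, br0, bx1, bu1, br1, bx2, bu2, br2, bE0, _, _, bs1, bc2, bratio⟩ := hbox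
  -- Phase-I derived facts
  have hwakeI := near_wake_phaseI hflow hτ hrows hTτ hwake hW4 (fun s hs => (henv s hs).1)
    (fun s hs => abs_le.mpr ⟨by linarith [(henv s hs).2.1.1], (henv s hs).2.1.2⟩) (fun s hs => (henv s hs).2.2.2.2.2.2.2.2.2.2.1)
    Tstar ⟨hT0, le_rfl⟩
  have hT147 : Tstar = 147 / 64 := rfl
  obtain ⟨hWT', hE3T', hE2T', hE1T'⟩ := hwakeI
  have hE3T : ∑ i, F i (-3) Tstar ≤ 2631 / 2500 := by linarith [hT147]
  have hE2T : ∑ i, F i (-2) Tstar ≤ 1473 / 2500 := by linarith [hT147]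
  have hE1T : ∑ i, F i (-1) Tstar ≤ 3187 / 10000 := by linarith [hT147]
  have hWT : ∑ i, F i (-2) Tstar + ∑ i, F i (-1) Tstar ≤ 3981 / 5000 := by linarith [hT147]
  have hEnv2 : ∀ s ∈ Icc (0 : ℝ) Tstar, F 0 2 s ≤ relayEnv₂ 2 := fun s hs => hEnv s hs 0 2 (by norm_num) le_rfl (by decide)
  have hEnv21 : ∀ s ∈ Icc (0 : ℝ) Tstar, F 2 1 s ≤ relayEnv₂ 1 := fun s hs => hEnv s hs 2 1 (by norm_num) (by norm_num) (by decide)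
  have hEnv12 : ∀ s ∈ Icc (0 : ℝ) Tstar, F 1 2 s ≤ relayEnv₂ 2 := fun s hs => hEnv s hs 1 2 (by norm_num) le_rfl (by decide)
  have hx2P : ∀ s ∈ Icc (0 : ℝ) Tstar, -(1 / 500 : ℝ) ≤ S 0 2 s ∧ S 0 2 s ≤ 3 / 250 := fun s hs => (henv s hs).2.2.2.2.2.2.1
  have hu2P : ∀ s ∈ Icc (0 : ℝ) Tstar, |S 1 2 s| ≤ 1 / 10 ^ 7 := fun s hs => by
    have h1 := (henv s hs).2.2.2.2.2.2.2.1; rw [abs_le]; constructor <;> linarith [h1.1, h1.2]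
  have hu1P : ∀ s ∈ Icc (0 : ℝ) Tstar, -(1 / 1000000 : ℝ) ≤ S 1 1 s ∧ S 1 1 s ≤ 4 / 25 := fun s hs => (henv s hs).2.2.2.2.1
  have hr1P : ∀ s ∈ Icc (0 : ℝ) Tstar, -(1 / 100000 : ℝ) ≤ S 2 1 s ∧ S 2 1 s ≤ 3 / 100000 := fun s hs => (henv s hs).2.2.2.2.2.1
  have hr2P : ∀ s ∈ Icc (0 : ℝ) Tstar, |S 2 2 s| ≤ 1 / 500000000 := fun s hs => by
    have h1 := (henv s hs).2.2.2.2.2.2.2.2.1; rw [abs_le]; constructor <;> linarith [h1.1, h1.2]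
  have hahead2 : ∀ i : Fin 4, i ≠ 3 → F₀ i 2 ≤ aheadE 2 := fun i hi => hahead 2 le_rfl i hi
  have hx2fl := x2_floor_phaseI hflow hrows hτ hκ0 le_rfl hκ0 le_rfl hTτ hahead2 hB2 hEnv2 hx2P hu2P
  have hr1fl := r1_floor_phaseI hflow hrows hτ hκ0 le_rfl hκ0 le_rfl hTτ hw9 hB1 hEnv21 hx2fl (fun s hs => (hx2P s hs).2)
    hu2P hu1P hr1P
  have hF3 : ∀ s ∈ Icc (0 : ℝ) Tstar, ∑ i, F i 3 s ≤ 6 / 10 ^ 20 :=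
    hT Tstar ⟨hT0, hTτ⟩ (by linarith [hT147]) (by unfold iota₁ at hI1; linarith) (by unfold iota₂ at hI2; linarith)
  have hisq := int_u1_sq_phaseI hflow hrows hτ hκ0 le_rfl hκ0 le_rfl hTτ hahead2 hB2 hEnv2 hx2P hu2P bx2.2
  have hiabs := int_abs_u1_phaseI hflow hTτ hisq
  have hu2fl := u2_floor_phaseI hflow hrows hτ hκ0 le_rfl hκ0 le_rfl hTτ hahead2 hB2 hEnv12 hF3 hx2fl (fun s hs => (hx2P s hs).2)
    hu2P hu1P hr1fl (fun s hs => (hr1P s hs).2) hr2P hiabs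
  -- numeric facts at T*
  have hTT : Tstar ∈ Icc (0 : ℝ) Tstar := ⟨hT0, le_rfl⟩
  have hc2T : S 0 2 Tstar ≤ ((cC2 : ℚ) : ℝ) + 10 / 19 * S 1 1 Tstar ^ 2 := by norm_num [cC2]; linarith [bc2]
  have hr2T : |S 2 2 Tstar| ≤ 1126 / 10 ^ 12 := abs_le.mpr ⟨by linarith [br2.1], by linarith [br2.2]⟩
  have hx2Tf : -(4 / 10 ^ 9 : ℝ) ≤ S 0 2 Tstar := hx2fl Tstar hTT
  have hu2Tf : -S 1 2 Tstar ≤ 29 / 10 ^ 10 := by linarith [hu2fl Tstar hTT]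
  have hr1Tf : -S 2 1 Tstar ≤ 22 / 10 ^ 9 := by linarith [hr1fl Tstar hTT]
  -- the Phase-II window lemma, packaged
  have hPW : ∀ t₁, Tstar ≤ t₁ → t₁ ≤ Tstar + 7 / 10 → (∀ s ∈ Icc Tstar t₁, S 1 1 s ≤ 4175 / 10000 * S 0 1 s) →
      ∀ t ∈ Icc Tstar t₁, _ := fun t₁ _ h2 hp =>
    phaseII_window hflow hrows hτ hT hW4 hA hEnv hI1 hI2 hB1 hB2 hu2P hE3T hE2T hE1T hWT (by linarith [bE0]) bu0 br0 bx0
      bs1 bu1 hc2T (by linarith [br1.2]) (by linarith [bu2.2]) hr2T hx2Tf hu2Tf hr1Tf (by linarith [hT147])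
      (by linarith) hp
  -- the crossing set and τ₁
  set C : Set ℝ := {s | s ∈ Icc Tstar (Tstar + 7 / 10) ∧ 4175 / 10000 * S 0 1 s ≤ S 1 1 s} with hCdef
  have hCne : C.Nonempty := by
    by_contra hnone
    rw [Set.not_nonempty_iff_eq_empty] at hnone
    have hp : ∀ s ∈ Icc Tstar (Tstar + 7 / 10), S 1 1 s ≤ 4175 / 10000 * S 0 1 s := by
      intro s hs
      by_contra hlt; push Not at hlt
      have : s ∈ C := ⟨hs, hlt.le⟩
      rw [hnone] at this; exact this
    have := ((hPW (Tstar + 7 / 10) (by linarith) le_rfl hp) (Tstar + 7 / 10) ⟨by linarith, le_rfl⟩).2.1.1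
    linarith
  have hCbdd : BddBelow C := ⟨Tstar, fun s hs => hs.1.1⟩
  have hcontg : ContinuousOn (fun s => 4175 / 10000 * S 0 1 s - S 1 1 s) (Icc Tstar (Tstar + 7 / 10)) :=
    ((continuousOn_const.mul (hflow.contDiffOn_S 0 1).continuousOn).sub (hflow.contDiffOn_S 1 1).continuousOn).mono
      (Icc_subset_Icc hT0 (by linarith [hT147]))
  have hCclosed : IsClosed C := by
    have e : C = Icc Tstar (Tstar + 7 / 10) ∩ (fun s => 4175 / 10000 * S 0 1 s - S 1 1 s) ⁻¹' (Iic 0) := by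
      ext s; simp only [hCdef, mem_setOf_eq, mem_inter_iff, mem_preimage, mem_Iic, sub_nonpos]
    rw [e]; exact hcontg.preimage_isClosed_of_isClosed isClosed_Icc isClosed_Iic
  set τ₁ : ℝ := sInf C with hτ₁
  have hmem : τ₁ ∈ C := hCclosed.csInf_mem hCne hCbdd
  obtain ⟨⟨hτ₁T, hτ₁7⟩, hcross⟩ := hmem
  have hbefore : ∀ s, Tstar ≤ s → s < τ₁ → S 1 1 s < 4175 / 10000 * S 0 1 s := by
    intro s hs hlt
    by_contra hge; push Not at hge
    have hsC : s ∈ C := ⟨⟨hs, by linarith⟩, hge⟩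
    have := csInf_le hCbdd hsC; linarith
  have hpre : ∀ s ∈ Icc Tstar τ₁, S 1 1 s ≤ 4175 / 10000 * S 0 1 s := by
    intro s hs
    rcases eq_or_lt_of_le hs.2 with heq | hlt
    · rw [heq]
      by_contra hgt; push Not at hgt
      have hgT : S 1 1 Tstar < 4175 / 10000 * S 0 1 Tstar := by linarith [bratio, bx1.1]
      have hne : Tstar ≠ τ₁ := fun h0 => by rw [← h0] at hgt; linarith
      have hlt : Tstar < τ₁ := lt_of_le_of_ne hτ₁T hne
      have h0mem : (0 : ℝ) ∈ Icc ((fun s => 4175 / 10000 * S 0 1 s - S 1 1 s) τ₁)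
          ((fun s => 4175 / 10000 * S 0 1 s - S 1 1 s) Tstar) := ⟨by simp only; linarith, by simp only; linarith⟩
      obtain ⟨s', hs', hs0⟩ := intermediate_value_Icc' hτ₁T (hcontg.mono (Icc_subset_Icc_right hτ₁7)) h0mem
      have hsC : s' ∈ C := ⟨⟨hs'.1, hs'.2.trans hτ₁7⟩, by simp only at hs0; linarith⟩
      have hle := csInf_le hCbdd hsC
      have hseq : s' = τ₁ := le_antisymm hs'.2 hle
      rw [hseq] at hs0; simp only at hs0; linarith
    · exact (hbefore s hs.1 hlt).le
  have heq : S 1 1 τ₁ = 4175 / 10000 * S 0 1 τ₁ := le_antisymm (hpre τ₁ ⟨hτ₁T, le_rfl⟩) hcross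
  -- the window facts at τ₁ (and at every time of [T*, τ₁])
  have hWF := hPW τ₁ hτ₁T hτ₁7 hpre
  obtain ⟨hcaps, hfine, hs1⟩ := hWF τ₁ ⟨hτ₁T, le_rfl⟩
  obtain ⟨q0, q1, q2, q3, q4, q5, q6, q7, q8, q9, q10, q11, q12, q13, q14, q15, q16, q17, q18, q19, q20, q21, q22⟩ := hcaps
  obtain ⟨fT, fX2, fR1, fU2, fU2m, fR1m, fI, fE3, fE2, fE1, fE0, fx2T, fr2, fK, frow⟩ := hfine
  set a : ℝ := S 0 1 τ₁ with ha
  have ha0 : 0 < a := by linarith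
  -- the crossing band
  have hok := ignitionTable_ok
  unfold tableCheck at hok
  simp only [Bool.and_eq_true] at hok
  have hrun : runCheck initState ignitionTable = true := hok.1.1
  have hall : ignitionTable.all landCheck = true := hok.1.2
  have hu1lo : 1447 / 100000 ≤ S 1 1 τ₁ := by linarith
  obtain ⟨r, hr, hwa, hwb⟩ := runCheck_cover ignitionTable initState hrun (S 1 1 τ₁) (by norm_num [initState]; linarith)
    ⟨⟨((48989 : ℚ) / 100000), ((19873 : ℚ) / 40000), ((68243 : ℚ) / 100000), ((3 : ℚ) / 100000),
      ((18207 : ℚ) / 5000000), ((777307 : ℚ) / 5000000), ((1114079 : ℚ) / 1000000000), ((884809 : ℚ) / 100000000000),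
      ((65363 : ℚ) / 10000000000000), ((1323 : ℚ) / 20000000000), ((20369 : ℚ) / 20000), ((3406489 : ℚ) / 5000000),
      ((3009 : ℚ) / 1000000000000000)⟩, by rfl, by push_cast; linarith⟩
  obtain ⟨rX2, rR1, rU2, rU2m, rR1m, rT, rI⟩ := frow r hr hwb
  have hland : landCheck r = true := List.all_eq_true.mp hall r hr
  unfold landCheck at hland
  have hcond : cRho * (cS0 - r.X2) ≤ r.wb := by
    by_contra hnot
    push Not at hnot
    have h1 : ((r.wb : ℚ) : ℝ) < ((cRho : ℚ) : ℝ) * (((cS0 : ℚ) : ℝ) - ((r.X2 : ℚ) : ℝ)) := by exact_mod_cast hnot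
    norm_num [cRho, cS0] at h1
    linarith [hs1, rX2, hwb, heq]
  rw [if_pos hcond] at hland
  simp only [Bool.and_eq_true, decide_eq_true_eq] at hland
  obtain ⟨⟨⟨⟨⟨⟨⟨⟨l1, l2⟩, l3⟩, l4⟩, l5⟩, l6⟩, l7⟩, l8⟩, l9⟩ := hland
  have L1 : 17 / 20 * (4175 / 10000 : ℝ) ≤ ((r.wa : ℚ) : ℝ) := by
    have h' := (Rat.cast_le (K := ℝ)).mpr l1; push_cast [cRho] at h'; linarith
  have L2 : ((r.X2 : ℚ) : ℝ) * (4175 / 10000) ≤ 15 / 100 * ((r.wa : ℚ) : ℝ) := by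
    have h' := (Rat.cast_le (K := ℝ)).mpr l2; push_cast [cRho] at h'; linarith
  have L3 : ((r.R1 : ℚ) : ℝ) * (4175 / 10000) ≤ 12 / 10000 * ((r.wa : ℚ) : ℝ) := by
    have h' := (Rat.cast_le (K := ℝ)).mpr l3; push_cast [cRho] at h'; linarith
  have L4 : ((r.U2 : ℚ) : ℝ) * (4175 / 10000) ≤ 1 / 100000 * ((r.wa : ℚ) : ℝ) := by
    have h' := (Rat.cast_le (K := ℝ)).mpr l4; push_cast [cRho] at h'; linarith
  have L5 : ((r.U2m : ℚ) : ℝ) * (4175 / 10000) ≤ 1 / 10 ^ 8 * ((r.wa : ℚ) : ℝ) := by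
    have h' := (Rat.cast_le (K := ℝ)).mpr l5; push_cast [cRho] at h'; linarith
  have L6 : 3703 / 10000 * (4175 / 10000 : ℝ) ^ 2 ≤ ((r.wa : ℚ) : ℝ) ^ 2 / 2 := by
    have h' := (Rat.cast_le (K := ℝ)).mpr l6; push_cast [cRho] at h'; linarith
  have L7 : 373 / 2000 * (4175 / 10000 : ℝ) ^ 2 ≤ ((r.wa : ℚ) : ℝ) ^ 2 / 4 := by
    have h' := (Rat.cast_le (K := ℝ)).mpr l7; push_cast [cRho] at h'; linarith
  have L8 : 3089 / 5000 * (4175 / 10000 : ℝ) ^ 2 ≤ ((r.wa : ℚ) : ℝ) ^ 2 := by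
    have h' := (Rat.cast_le (K := ℝ)).mpr l8; push_cast [cRho] at h'; linarith
  have L9 : 2671 / 2500 * (4175 / 10000 : ℝ) ^ 2 ≤ 2 * ((r.wa : ℚ) : ℝ) ^ 2 := by
    have h' := (Rat.cast_le (K := ℝ)).mpr l9; push_cast [cRho] at h'; linarith
  -- a ≥ wa/ρ
  have hwa' : ((r.wa : ℚ) : ℝ) ≤ 4175 / 10000 * a := by rw [ha]; linarith
  have hwapos : 0 ≤ ((r.wa : ℚ) : ℝ) := by linarith
  have ha85 : 17 / 20 ≤ a := by linarith
  have hwasq : ((r.wa : ℚ) : ℝ) ^ 2 ≤ (4175 / 10000) ^ 2 * a ^ 2 := by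
    have := pow_le_pow_left₀ hwapos hwa' 2; rw [mul_pow] at this; exact this
  have ha2 : 0 < a ^ 2 := by positivity
  have hτ₁τ : τ₁ ≤ τ := by linarith [hT147]
  refine ⟨τ₁, by linarith, by linarith [hT147], ha85, heq, ?_, ?_, ?_, ?_, ?_⟩
  · -- amplitude ratios with floors
    refine ⟨?_, ?_, ?_, ?_, ?_, ?_, ?_, ?_⟩
    · rw [le_div_iff₀ ha0]; linarith
    · rw [div_le_iff₀ ha0]; linarith
    · rw [le_div_iff₀ ha0]; linarith
    · rw [div_le_iff₀ ha0]; linarith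
    · rw [le_div_iff₀ ha0]; linarith
    · rw [div_le_iff₀ ha0]; linarith
    · rw [le_div_iff₀ ha0]; have := (abs_le.mp fr2).1; linarith
    · rw [div_le_iff₀ ha0]; have := (abs_le.mp fr2).2; linarith
  · -- near wake shells
    intro k hk1 hk2
    rw [div_le_iff₀ ha2]
    interval_cases k
    · rw [show (1 + (-4 : ℤ)) = -3 by norm_num, wakeS_neg_four]; linarith
    · rw [show (1 + (-3 : ℤ)) = -2 by norm_num, wakeS_neg_three]; linarith
    · rw [show (1 + (-2 : ℤ)) = -1 by norm_num, wakeS_neg_two]; linarith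
    · rw [show (1 + (-1 : ℤ)) = 0 by norm_num, wakeS_neg_one]; linarith
  · -- epoch envelope of old shells 0, 1, 2 on [0, τ₁]
    intro s hs i k hk0 hk2 hi
    rcases le_or_gt s Tstar with hsT | hsT
    · exact hEnv s ⟨hs.1, hsT⟩ i k hk0 hk2 hi
    · have hsW : s ∈ Icc Tstar τ₁ := ⟨hsT.le, hs.2⟩
      have hsτ : s ≤ τ := hs.2.trans hτ₁τ
      obtain ⟨⟨p0, p1, p2, p3, p4, p5, p6, p7, p8, p9, p10, p11, p12, p13, p14, p15, p16, p17, p18, p19, p20, p21, p22⟩, _, _⟩ := hWF s hsW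
      have hs07 : s - Tstar ≤ 7 / 10 := by linarith [hs.2]
      have hA' : ∀ (i : Fin 4) (k : ℤ), -3 ≤ k → ∀ r' ∈ Icc Tstar s, F i k r' ≤ 5 / 2 := by
        intro i' k' hk' r' hr'
        have hrτ : r' ∈ Icc 0 τ := ⟨hT0.trans hr'.1, hr'.2.trans hsτ⟩
        have h1 : F i' k' r' ≤ ∑ j, F j k' r' :=
          Finset.single_le_sum (f := fun j => F j k' r') (fun j _ => hflow.nonneg_F j k' r' hrτ) (Finset.mem_univ i')
        exact h1.trans (hA r' hrτ (by linarith [hr'.2, hT147]) k' hk')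
      have slack : ∀ (i' : Fin 4) (k' : ℤ) (M₁ : ℝ), 0 ≤ k' → k' ≤ 2 → i' ≠ 3 → relayEnv₂ k' = M₁ →
          F i' k' s ≤ (1 / 2) * S i' k' s ^ 2 + B₀ i' k' + 1 / 10 ^ 8 * (1 + 1 : ℝ) ^ ((2 : ℝ) * k') * (M₁ * Tstar + 5 / 2 * (s - Tstar)) :=
        fun i' k' M₁ hk0' hk2' hi' hM =>
          energy_le_slack₂ hflow hκ0 i' k' hT0 hsT.le hsτ (fun r hr => hM ▸ hEnv r hr i' k' hk0' hk2' hi') (hA' i' k' (by omega))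
      have hs0' : 0 ≤ s - Tstar := by linarith
      rw [hT147] at hs07 hs0'
      interval_cases k
      · have hsl := slack i 0 2 le_rfl (by norm_num) hi relayEnv₂_zero
        rw [weight_at_zero, hT147] at hsl
        rw [relayEnv₂_zero]
        fin_cases i <;> simp only [Fin.zero_eta, Fin.mk_one, Fin.reduceFinMk] at hsl ⊢
        · have : S 0 0 s ^ 2 ≤ (38 / 100) ^ 2 := sq_le_sq' (by linarith) p14
          linarith [hB00 0]
        · have : S 1 0 s ^ 2 ≤ (47 / 100) ^ 2 := sq_le_sq' (by linarith) p10
          linarith [hB00 1]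
        · have : S 2 0 s ^ 2 ≤ (43 / 1000) ^ 2 := sq_le_sq' (by linarith) p12
          linarith [hB00 2]
        · exact absurd rfl hi
      · have hsl := slack i 1 1 (by norm_num) (by norm_num) hi relayEnv₂_one
        rw [weight_at_one, hT147] at hsl
        rw [relayEnv₂_one]
        fin_cases i <;> simp only [Fin.zero_eta, Fin.mk_one, Fin.reduceFinMk] at hsl ⊢
        · have : S 0 1 s ^ 2 ≤ (126 / 100) ^ 2 := sq_le_sq' (by linarith) p19
          linarith [hB1 0]
        · have : S 1 1 s ^ 2 ≤ (4969 / 10000) ^ 2 := sq_le_sq' (by linarith) p16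
          linarith [hB1 1]
        · have : S 2 1 s ^ 2 ≤ (12 / 10000) ^ 2 := sq_le_sq' (by linarith) p2
          linarith [hB1 2]
        · exact absurd rfl hi
      · have hsl := slack i 2 (1 / 2) (by norm_num) le_rfl hi relayEnv₂_two
        rw [weight_at_two, hT147] at hsl
        rw [relayEnv₂_two]
        fin_cases i <;> simp only [Fin.zero_eta, Fin.mk_one, Fin.reduceFinMk] at hsl ⊢
        · have : S 0 2 s ^ 2 ≤ (16 / 100) ^ 2 := sq_le_sq' (by linarith) p0
          linarith [hB2 0]
        · have : S 1 2 s ^ 2 ≤ (1 / 10 ^ 5) ^ 2 := sq_le_sq' (by linarith) p4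
          linarith [hB2 1]
        · have : S 2 2 s ^ 2 ≤ (13 / 10 ^ 10) ^ 2 := by
            rw [← sq_abs]; exact pow_le_pow_left₀ (abs_nonneg _) p22 2
          linarith [hB2 2]
        · exact absurd rfl hi
  · -- ∫₀^{τ₁} u₂²
    have hcu : ContinuousOn (fun s => S 1 2 s) (Icc 0 τ) := (hflow.contDiffOn_S 1 2).continuousOn
    have hi1 : IntervalIntegrable (fun s => S 1 2 s ^ 2) volume 0 Tstar :=
      ((hcu.mono (by rw [uIcc_of_le hT0]; exact Icc_subset_Icc_right hTτ)).pow 2).intervalIntegrable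
    have hi2 : IntervalIntegrable (fun s => S 1 2 s ^ 2) volume Tstar τ₁ :=
      ((hcu.mono (by rw [uIcc_of_le hτ₁T]; exact Icc_subset_Icc hT0 hτ₁τ)).pow 2).intervalIntegrable
    rw [← intervalIntegral.integral_add_adjacent_intervals hi1 hi2]
    unfold iota₁ at hI1; linarith
  · -- ∫₀^{τ₁} |r₂ u₂|
    have hcu : ContinuousOn (fun s => S 1 2 s) (Icc 0 τ) := (hflow.contDiffOn_S 1 2).continuousOn
    have hcr : ContinuousOn (fun s => S 2 2 s) (Icc 0 τ) := (hflow.contDiffOn_S 2 2).continuousOn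
    have hj1 : IntervalIntegrable (fun s => |S 2 2 s * S 1 2 s|) volume 0 Tstar :=
      (((hcr.mul hcu).mono (by rw [uIcc_of_le hT0]; exact Icc_subset_Icc_right hTτ)).abs).intervalIntegrable
    have hj2 : IntervalIntegrable (fun s => |S 2 2 s * S 1 2 s|) volume Tstar τ₁ :=
      (((hcr.mul hcu).mono (by rw [uIcc_of_le hτ₁T]; exact Icc_subset_Icc hT0 hτ₁τ)).abs).intervalIntegrable
    rw [← intervalIntegral.integral_add_adjacent_intervals hj1 hj2]
    unfold iota₂ at hI2; linarith

end Summit.NavierStokesRegularity.NavierStokesRegularity.Cruxes.RelayFrontStep.Window2
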